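import Mathlib
import Summits.Ventures.PercRepro2.TypedPendantA3AtO
import Summits.Ventures.PercRepro2.TypedPendantA3AtRootRow

/-!
# The pendant `a₃` at `b`: `(N₀, N₁, N₂, N₃) = (N₀, 3N₀ − X, 2N₀ + N₃ − X, N₃)` (blind cell
PercRepro2, mine-2 g54, 2026-08-29; `conjectures/MINE-2.md` M2-117)

The last marked attachment point of the pendant-`a₃` table.  For a typed edge `f = {a₃, b}` whose
end `a₃` is a leaf carrying exactly the mark `a₃`, the coincidence `b = a₃` is LIVE (the class-`3`
base `N₃` is the typed base of the instance with `f` pinned open, one typed edge fewer), and the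
other two classes are determined by `N₀` (`a₃` isolated), `N₃` and ONE two-copy quantity:

  **`typedCount_pendant_a3_at_b_two`**: `N_{τ[f:=2]} = 2·N_{τ[f:=0]} + N_{τ[f:=3]} − X`,
  **`typedCount_pendant_a3_at_b_one`**: `N_{τ[f:=1]} = 3·N_{τ[f:=0]} − X`,

`X = typedCount F z (τ[f:=0]) (1_Q(x)·(1_{b∈C(a₂)}(x)·Cov_{y,w}(1_{o∈C(a₁)}, σ_b) − 1_{b∈C(a₁)}(x)·Cov_{y,w}(1_{o∈C(a₂)}, σ_b)))`
— the spectator's side of `b` selects the root-row covariance of the OTHER root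
(`TypedPendantA3AtRoot.lean`: at `a₂` the class-`2` base is the `Q`-weighted count of
`Cov(1_{o∈C(a₁)}, σ_b)`, at `a₁` of `−Cov(1_{o∈C(a₂)}, σ_b)`), so `X ≥ 0` under the typed same-side
and cross statements for the pair `(o, b)` at both roots, and the row says `N₁ ≤ 3N₀`,
`N₂ ≤ 2N₀ + N₃` there.  Mechanism: in a copy with `f` open, `a₃` carries the side data of `b`
(`1_PD = 1_Q·1_{b∉U}`, `σ₃ = σ_b`); the identity `N₂ − N₃ − 2N₀ + X = 0` is NOT pointwise but holds
after SYMMETRISING over the six copy permutations (`KB_pendant_a3_at_b_sym`, a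
`linear_combination` modulo the `b`-realisation relation `1_Q·1_{b∉U} = 1_Q·(1 − 1_{b∈C(a₁)} − 1_{b∈C(a₂)})`
and `1_Q·1_{b∈C(a₁)}·1_{b∈C(a₂)} = 0`, multipliers computed symbolically), and the typed count of
the symmetrised kernel is six times the typed count (`typedCount_sym6`, the copy swaps) — hence
the identity over every field of characteristic `0`.  Own work; standard axioms.
-/

namespace Summit.Ventures.PercRepro2

namespace CovForm

namespace TypedRed

open OneTyped

/-! ## States: a copy with `a₃` carrying the side data of `b` -/

section States

/-- On a state with `a₃` carrying the side data of `b`, `1_PD = 1_Q · 1_{b ∉ U}`. -/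
lemma pdB_coinc_b (s : St) (h : s.L3 = s.Lb ∧ s.H3 = s.Hb) :
    pdB s = qB s * (if s.Lb || s.Hb then 0 else 1) := by
  obtain ⟨q, lo, ho, lb, hb, l3, h3⟩ := s
  simp only [St.Lb, St.Hb, St.L3, St.H3] at h
  obtain ⟨h1, h2⟩ := h
  subst h1
  subst h2
  cases q <;> cases l3 <;> cases h3 <;> simp [pdB, qB, St.q', St.Lb, St.Hb, St.L3, St.H3]

/-- On a REALISED state (under `Q` the mark `b` is in at most one root cluster),
`1_Q · 1_{b ∉ U} = 1_Q · (1 − 1_{b∈C(a₁)} − 1_{b∈C(a₂)})`. -/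
lemma qB_mul_nbB_of_real (s : St) (h : s.q' = false → ¬ (s.Lb = true ∧ s.Hb = true)) :
    qB s * (if s.Lb || s.Hb then 0 else 1) =
      qB s * (1 - (if s.Lb = true then 1 else 0) - (if s.Hb = true then 1 else 0)) := by
  obtain ⟨q, lo, ho, lb, hb, l3, h3⟩ := s
  simp only [St.q', St.Lb, St.Hb] at h
  cases q <;> cases lb <;> cases hb <;> simp [qB, St.q', St.Lb, St.Hb] at h ⊢

/-- On a realised state, `1_Q · 1_{b∈C(a₁)} · 1_{b∈C(a₂)} = 0`. -/
lemma qB_mul_lb_mul_hb_of_real (s : St) (h : s.q' = false → ¬ (s.Lb = true ∧ s.Hb = true)) :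
    qB s * (if s.Lb = true then 1 else 0) * (if s.Hb = true then 1 else 0) = 0 := by
  obtain ⟨q, lo, ho, lb, hb, l3, h3⟩ := s
  simp only [St.q', St.Lb, St.Hb] at h
  cases q <;> cases lb <;> cases hb <;> simp [qB, St.q', St.Lb, St.Hb] at h ⊢

/-- **The symmetrised identity at `b`**: for realised states `x, y, w` with `a₃` carrying the side
data of `b`, the kernel `Z = (the three class-2 placements) − (the class-3 term) − 2·(the
class-0 term) + X` summed over the six permutations of the copies vanishes
(`X = 1_Q³·(σ_b(y) − σ_b(w))·(1_{b∈C(a₂)}(x)(1_{o∈C(a₁)}(y) − 1_{o∈C(a₁)}(w)) − 1_{b∈C(a₁)}(x)(1_{o∈C(a₂)}(y) − 1_{o∈C(a₂)}(w)))`). -/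
theorem KB_pendant_a3_at_b_sym (x y w : St) (hx : x.L3 = x.Lb ∧ x.H3 = x.Hb)
    (hy : y.L3 = y.Lb ∧ y.H3 = y.Hb) (hw : w.L3 = w.Lb ∧ w.H3 = w.Hb)
    (rx : x.q' = false → ¬ (x.Lb = true ∧ x.Hb = true))
    (ry : y.q' = false → ¬ (y.Lb = true ∧ y.Hb = true))
    (rw' : w.q' = false → ¬ (w.Lb = true ∧ w.Hb = true)) :
    (KB (kill3 x) y w + KB x (kill3 y) w + KB x y (kill3 w) - KB x y w - 2 * KB (kill3 x) (kill3 y) (kill3 w) + qB x * qB y * qB w * ((sigB y.Lb y.Hb - sigB w.Lb w.Hb) * ((if x.Hb = true then 1 else 0) * ((if y.Lo = true then 1 else 0) - (if w.Lo = true then 1 else 0)) - (if x.Lb = true then 1 else 0) * ((if y.Ho = true then 1 else 0) - (if w.Ho = true then 1 else 0))))) +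
      (KB (kill3 x) w y + KB x (kill3 w) y + KB x w (kill3 y) - KB x w y - 2 * KB (kill3 x) (kill3 w) (kill3 y) + qB x * qB w * qB y * ((sigB w.Lb w.Hb - sigB y.Lb y.Hb) * ((if x.Hb = true then 1 else 0) * ((if w.Lo = true then 1 else 0) - (if y.Lo = true then 1 else 0)) - (if x.Lb = true then 1 else 0) * ((if w.Ho = true then 1 else 0) - (if y.Ho = true then 1 else 0))))) +
      (KB (kill3 y) x w + KB y (kill3 x) w + KB y x (kill3 w) - KB y x w - 2 * KB (kill3 y) (kill3 x) (kill3 w) + qB y * qB x * qB w * ((sigB x.Lb x.Hb - sigB w.Lb w.Hb) * ((if y.Hb = true then 1 else 0) * ((if x.Lo = true then 1 else 0) - (if w.Lo = true then 1 else 0)) - (if y.Lb = true then 1 else 0) * ((if x.Ho = true then 1 else 0) - (if w.Ho = true then 1 else 0))))) +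
      (KB (kill3 y) w x + KB y (kill3 w) x + KB y w (kill3 x) - KB y w x - 2 * KB (kill3 y) (kill3 w) (kill3 x) + qB y * qB w * qB x * ((sigB w.Lb w.Hb - sigB x.Lb x.Hb) * ((if y.Hb = true then 1 else 0) * ((if w.Lo = true then 1 else 0) - (if x.Lo = true then 1 else 0)) - (if y.Lb = true then 1 else 0) * ((if w.Ho = true then 1 else 0) - (if x.Ho = true then 1 else 0))))) +
      (KB (kill3 w) x y + KB w (kill3 x) y + KB w x (kill3 y) - KB w x y - 2 * KB (kill3 w) (kill3 x) (kill3 y) + qB w * qB x * qB y * ((sigB x.Lb x.Hb - sigB y.Lb y.Hb) * ((if w.Hb = true then 1 else 0) * ((if x.Lo = true then 1 else 0) - (if y.Lo = true then 1 else 0)) - (if w.Lb = true then 1 else 0) * ((if x.Ho = true then 1 else 0) - (if y.Ho = true then 1 else 0))))) +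
      (KB (kill3 w) y x + KB w (kill3 y) x + KB w y (kill3 x) - KB w y x - 2 * KB (kill3 w) (kill3 y) (kill3 x) + qB w * qB y * qB x * ((sigB y.Lb y.Hb - sigB x.Lb x.Hb) * ((if w.Hb = true then 1 else 0) * ((if y.Lo = true then 1 else 0) - (if x.Lo = true then 1 else 0)) - (if w.Lb = true then 1 else 0) * ((if y.Ho = true then 1 else 0) - (if x.Ho = true then 1 else 0))))) = 0 := by
  have hEx := qB_mul_nbB_of_real x rx
  have hEy := qB_mul_nbB_of_real y ry
  have hEw := qB_mul_nbB_of_real w rw'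
  have hI2x := qB_mul_lb_mul_hb_of_real x rx
  have hI2y := qB_mul_lb_mul_hb_of_real y ry
  have hI2w := qB_mul_lb_mul_hb_of_real w rw'
  simp only [KB, pdB_kill3, qB_kill3, kill3_Lo, kill3_Ho, kill3_Lb, kill3_Hb, kill3_L3, kill3_H3,
    sigB_ff, pdB_coinc_b x hx, pdB_coinc_b y hy, pdB_coinc_b w hw, hx.1, hx.2, hy.1, hy.2, hw.1,
    hw.2]
  simp only [sigB, uB] at hEx hEy hEw hI2x hI2y hI2w ⊢
  set qx := qB x with hqx
  set nbx : ℤ := (if x.Lb || x.Hb then 0 else 1) with hnbx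
  set lox : ℤ := (if x.Lo = true then 1 else 0) with hlox
  set hox : ℤ := (if x.Ho = true then 1 else 0) with hhox
  set lbx : ℤ := (if x.Lb = true then 1 else 0) with hlbx
  set hbx : ℤ := (if x.Hb = true then 1 else 0) with hhbx
  set qy := qB y with hqy
  set nby : ℤ := (if y.Lb || y.Hb then 0 else 1) with hnby
  set loy : ℤ := (if y.Lo = true then 1 else 0) with hloy
  set hoy : ℤ := (if y.Ho = true then 1 else 0) with hhoy
  set lby : ℤ := (if y.Lb = true then 1 else 0) with hlby
  set hby : ℤ := (if y.Hb = true then 1 else 0) with hhby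
  set qw := qB w with hqw
  set nbw : ℤ := (if w.Lb || w.Hb then 0 else 1) with hnbw
  set low : ℤ := (if w.Lo = true then 1 else 0) with hlow
  set how : ℤ := (if w.Ho = true then 1 else 0) with hhow
  set lbw : ℤ := (if w.Lb = true then 1 else 0) with hlbw
  set hbw : ℤ := (if w.Hb = true then 1 else 0) with hhbw
  linear_combination
    ((-2) * qx * qy * how * hbw + (-2) * qx * qy * how * lbw + (-2) * qx * qy * low * hbw + (-2) * qx * qy * low * lbw + qx * qy * hby * how + qx * qy * hby * low + qx * qy * lby * how + qx * qy * lby * low + qx * qy * hoy * hbw + qx * qy * hoy * lbw + (-2) * qx * qy * hoy * lby + qx * qy * loy * hbw + qx * qy * loy * lbw + (-2) * qx * qy * loy * hby + qx * hbx * qy * how + qx * hbx * qy * low + (-1) * qx * hbx * qy * hoy + qx * hbx * qy * loy + qx * lbx * qy * how + qx * lbx * qy * low + qx * lbx * qy * hoy + (-1) * qx * lbx * qy * loy + qx * hox * qy * hbw + qx * hox * qy * lbw + (-1) * qx * hox * qy * hby + qx * hox * qy * lby + (-2) * qx * hox * lbx * qy + qx * lox * qy * hbw + qx * lox * qy * lbw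 + qx * lox * qy * hby + (-1) * qx * lox * qy * lby + (-2) * qx * lox * hbx * qy) * hEw +
    ((-2) * qy * qw * how * lbw + (-2) * qy * qw * low * hbw + (-1) * qy * hby * qw * how + qy * hby * qw * low + qy * lby * qw * how + (-1) * qy * lby * qw * low + (-1) * qy * hoy * qw * hbw + qy * hoy * qw * lbw + (-2) * qy * hoy * lby * qw + qy * loy * qw * hbw + (-1) * qy * loy * qw * lbw + (-2) * qy * loy * hby * qw + hbx * qy * qw * how + hbx * qy * qw * low + hbx * qy * hoy * qw + hbx * qy * loy * qw + lbx * qy * qw * how + lbx * qy * qw * low + lbx * qy * hoy * qw + lbx * qy * loy * qw + hox * qy * qw * hbw + hox * qy * qw * lbw + hox * qy * hby * qw + hox * qy * lby * qw + (-2) * hox * hbx * qy * qw + (-2) * hox * lbx * qy * qw + lox * qy * qw * hbw + lox * qy * qw * lbw + lox * qy * hby * qw + lox * qy * lby * qw + (-2) * lox * hbx * qy * qw + (-2) * lox * lbx * qy * qw) * hEx +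
    ((-2) * qx * qw * how * lbw + (-2) * qx * qw * low * hbw + qx * hby * qw * how + qx * hby * qw * low + qx * lby * qw * how + qx * lby * qw * low + qx * hoy * qw * hbw + qx * hoy * qw * lbw + (-2) * qx * hoy * hby * qw + (-2) * qx * hoy * lby * qw + qx * loy * qw * hbw + qx * loy * qw * lbw + (-2) * qx * loy * hby * qw + (-2) * qx * loy * lby * qw + (-1) * qx * hbx * qw * how + qx * hbx * qw * low + qx * hbx * hoy * qw + qx * hbx * loy * qw + qx * lbx * qw * how + (-1) * qx * lbx * qw * low + qx * lbx * hoy * qw + qx * lbx * loy * qw + (-1) * qx * hox * qw * hbw + qx * hox * qw * lbw + qx * hox * hby * qw + qx * hox * lby * qw + (-2) * qx * hox * lbx * qw + qx * lox * qw * hbw + (-1) * qx * lox * qw * lbw + qx * lox * hby * qw + qx * lox * lby * qw + (-2) * qx * lox * hbx * qw) * hEy +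
    ((8) * qx * qy * how + (8) * qx * qy * low + (-4) * qx * qy * hoy + (-4) * qx * qy * loy + (-4) * qx * hox * qy + (-4) * qx * lox * qy) * hI2w +
    ((-4) * qy * qw * how + (-4) * qy * qw * low + (-4) * qy * hoy * qw + (-4) * qy * loy * qw + (8) * hox * qy * qw + (8) * lox * qy * qw) * hI2x +
    ((-4) * qx * qw * how + (-4) * qx * qw * low + (8) * qx * hoy * qw + (8) * qx * loy * qw + (-4) * qx * hox * qw + (-4) * qx * lox * qw) * hI2y

end States

/-! ## The typed count of the symmetrised kernel -/

section Sym

variable {E : Type*} [Fintype E] [DecidableEq E] {R : Type*} [Field R]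

/-- The typed count of the kernel summed over the six copy permutations is six times the typed
count. -/
theorem typedCount_sym6 (F : Finset E) (z : Config E) (τ : E → ℕ)
    (K : Config E → Config E → Config E → R) :
    typedCount F z τ (fun x y w =>
      K x y w + K x w y + K y x w + K y w x + K w x y + K w y x) = 6 * typedCount F z τ K := by
  have h1 : typedCount F z τ (fun x y w => K y w x) = typedCount F z τ K :=
    (TypedA3.typedCount_swap12 F z τ (fun x y w => K x w y)).trans (typedCount_swap23' F z τ K)
  have h2 : typedCount F z τ (fun x y w => K w x y) = typedCount F z τ K :=
    (TypedA3.typedCount_swap12 F z τ (fun x y w => K w y x)).trans (typedCount_swap13' F z τ K)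
  rw [typedCount_add, typedCount_add, typedCount_add, typedCount_add, typedCount_add,
    typedCount_swap23' F z τ K, TypedA3.typedCount_swap12 F z τ K, typedCount_swap13' F z τ K,
    h1, h2]
  ring

end Sym

/-! ## The theorems -/

section Main

open Classical

variable {V : Type*} {E : Type*} [Fintype E] [DecidableEq E] {R : Type*} [Field R]
variable (ends : E → Sym2 V) (o a₁ a₂ a₃ b : V)

omit [Fintype E] [DecidableEq E] in
/-- A realised state: under `Q` the mark `b` lies in at most one root cluster. -/
lemma st_real_b (ω : Config E) :
    (st ends o a₁ a₂ a₃ b ω).q' = false →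
      ¬ ((st ends o a₁ a₂ a₃ b ω).Lb = true ∧ (st ends o a₁ a₂ a₃ b ω).Hb = true) := by
  unfold st
  simp only [St.q', St.Lb, St.Hb, decide_eq_false_iff_not, decide_eq_true_eq]
  intro h hc
  exact h (conn_trans hc.2 (conn_symm hc.1))

omit [Fintype E] [DecidableEq E] in
/-- With `f = {a₃, b}` open, `a₃` carries the side data of `b`. -/
lemma st_coinc_b_of_open {f : E} (hf : ends f = s(a₃, b)) (x : Config E) (hx : x f = true) :
    (st ends o a₁ a₂ a₃ b x).L3 = (st ends o a₁ a₂ a₃ b x).Lb ∧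
      (st ends o a₁ a₂ a₃ b x).H3 = (st ends o a₁ a₂ a₃ b x).Hb := by
  have key : ∀ p : V, Conn ends x p a₃ ↔ Conn ends x p b := fun p =>
    ⟨fun h => conn_symm ((conn_leaf_open hf hx).1 (conn_symm h)),
     fun h => conn_symm ((conn_leaf_open hf hx).2 (conn_symm h))⟩
  exact ⟨decide_eq_decide.mpr (key a₁), decide_eq_decide.mpr (key a₂)⟩

omit [Fintype E] [DecidableEq E] in
/-- `1_{b ∈ C(a₁)}` through the state. -/
lemma iL_b_eq_st (ω : Config E) :
    iL ends a₁ b ω = (((if (st ends o a₁ a₂ a₃ b ω).Lb = true then 1 else 0 : ℤ)) : R) := by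
  rw [iL_eq_dec]
  rfl

omit [Fintype E] [DecidableEq E] in
/-- `1_{b ∈ C(a₂)}` through the state. -/
lemma iH_b_eq_st (ω : Config E) :
    iH ends a₂ b ω = (((if (st ends o a₁ a₂ a₃ b ω).Hb = true then 1 else 0 : ℤ)) : R) := by
  rw [iH_eq_dec]
  rfl

/-- **The pendant `a₃` at `b`, class `2`**: `N_{τ[f:=2]} = 2·N_{τ[f:=0]} + N_{τ[f:=3]} − X`. -/
theorem typedCount_pendant_a3_at_b_two [CharZero R] {f : E} (hf : ends f = s(a₃, b))
    (hleaf : ∀ e, a₃ ∈ ends e → e = f) (h3b : a₃ ≠ b) (h3o : a₃ ≠ o) (h31 : a₃ ≠ a₁)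
    (h32 : a₃ ≠ a₂) (F : Finset E) (hfF : f ∈ F) (z : Config E) (τ : E → ℕ) :
    typedCount F z (Function.update τ f 2)
        (K3 ends o a₁ a₂ a₃ b : Config E → Config E → Config E → R) =
      2 * typedCount F z (Function.update τ f 0) (K3 ends o a₁ a₂ a₃ b) +
        typedCount F z (Function.update τ f 3) (K3 ends o a₁ a₂ a₃ b) -
        typedCount F z (Function.update τ f 0) (fun x y w =>
          iQ ends a₁ a₂ x * (iH ends a₂ b x *
            TypedA3.covKer ends a₁ a₂ (iL ends a₁ o) (sigma ends a₁ a₂ b) y w -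
            iL ends a₁ b x *
              TypedA3.covKer ends a₁ a₂ (iH ends a₂ o) (sigma ends a₁ a₂ b) y w)) := by
  set S := st ends o a₁ a₂ a₃ b with hS
  have hst : ∀ x : Config E, S (Function.update x f false) =
      kill3 (S (Function.update x f true)) := fun x =>
    st_update_pendant_a3 ends o a₁ a₂ a₃ b hf hleaf h3b h3o h31 h32 h3b x
  have hco : ∀ x : Config E, (S (Function.update x f true)).L3 = (S (Function.update x f true)).Lb ∧
      (S (Function.update x f true)).H3 = (S (Function.update x f true)).Hb := fun x =>
    st_coinc_b_of_open ends o a₁ a₂ a₃ b hf _ (Function.update_self f true x)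
  have hre : ∀ x : Config E, (S x).q' = false → ¬ ((S x).Lb = true ∧ (S x).Hb = true) :=
    st_real_b ends o a₁ a₂ a₃ b
  rw [typedCount_split_two F f hfF, typedCount_split_zero F f hfF, typedCount_split_three F f hfF,
    typedCount_split_zero F f hfF]
  -- the combined kernel on the split instance
  set Zc : Config E → Config E → Config E → R := fun x y w =>
    (K3 ends o a₁ a₂ a₃ b (Function.update x f false) (Function.update y f true)
        (Function.update w f true) : R) +
      K3 ends o a₁ a₂ a₃ b (Function.update x f true) (Function.update y f false)
        (Function.update w f true) +
      K3 ends o a₁ a₂ a₃ b (Function.update x f true) (Function.update y f true)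
        (Function.update w f false) +
      -(K3 ends o a₁ a₂ a₃ b (Function.update x f true) (Function.update y f true)
        (Function.update w f true)) +
      -(K3 ends o a₁ a₂ a₃ b (Function.update x f false) (Function.update y f false)
        (Function.update w f false)) +
      -(K3 ends o a₁ a₂ a₃ b (Function.update x f false) (Function.update y f false)
        (Function.update w f false)) +
      iQ ends a₁ a₂ (Function.update x f false) *
        (iH ends a₂ b (Function.update x f false) *
          TypedA3.covKer ends a₁ a₂ (iL ends a₁ o) (sigma ends a₁ a₂ b) (Function.update y f false)
            (Function.update w f false) -
          iL ends a₁ b (Function.update x f false) *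
            TypedA3.covKer ends a₁ a₂ (iH ends a₂ o) (sigma ends a₁ a₂ b)
              (Function.update y f false) (Function.update w f false)) with hZc
  -- the symmetrised kernel vanishes pointwise
  have hsym : ∀ x y w : Config E,
      Zc x y w + Zc x w y + Zc y x w + Zc y w x + Zc w x y + Zc w y x = 0 := by
    intro x y w
    have h := congrArg (Int.cast : ℤ → R) (KB_pendant_a3_at_b_sym (S (Function.update x f true))
      (S (Function.update y f true)) (S (Function.update w f true)) (hco x) (hco y) (hco w)
      (hre _) (hre _) (hre _))
    simp only [hZc, K3_eq_KB, ← hS, hst]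
    unfold TypedA3.covKer
    simp only [iQ_eq_st ends o a₁ a₂ a₃ b, iL_o_eq_st ends o a₁ a₂ a₃ b,
      iH_o_eq_st ends o a₁ a₂ a₃ b, iL_b_eq_st ends o a₁ a₂ a₃ b, iH_b_eq_st ends o a₁ a₂ a₃ b,
      sigma_b_eq_st ends o a₁ a₂ a₃ b, ← hS, hst, qB_kill3, kill3_Lo, kill3_Ho, kill3_Lb,
      kill3_Hb]
    push_cast at h ⊢
    linear_combination h
  have hZ : typedCount (F.erase f) (Function.update z f false) τ Zc = 0 := by
    have h6 := typedCount_sym6 (F.erase f) (Function.update z f false) τ Zc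
    rw [typedCount_congr_K _ _ _ hsym] at h6
    have h0 : typedCount (F.erase f) (Function.update z f false) τ
        (fun _ _ _ : Config E => (0 : R)) = 0 := by
      unfold typedCount
      simp
    rw [h0] at h6
    exact (mul_eq_zero.1 h6.symm).resolve_left (by norm_num)
  rw [hZc] at hZ
  rw [typedCount_add, typedCount_add, typedCount_add, typedCount_add, typedCount_add,
    typedCount_add, TypedA3.typedCount_neg', TypedA3.typedCount_neg'] at hZ
  linear_combination hZ

/-- **The pendant `a₃` at `b`, class `1`**: `N_{τ[f:=1]} = 3·N_{τ[f:=0]} − X` (the quadratic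
identity with the class-`2` identity). -/
theorem typedCount_pendant_a3_at_b_one [CharZero R] {f : E} (hf : ends f = s(a₃, b))
    (hleaf : ∀ e, a₃ ∈ ends e → e = f) (h3b : a₃ ≠ b) (h3o : a₃ ≠ o) (h31 : a₃ ≠ a₁)
    (h32 : a₃ ≠ a₂) (F : Finset E) (hfF : f ∈ F) (z : Config E) (τ : E → ℕ) :
    typedCount F z (Function.update τ f 1)
        (K3 ends o a₁ a₂ a₃ b : Config E → Config E → Config E → R) =
      3 * typedCount F z (Function.update τ f 0) (K3 ends o a₁ a₂ a₃ b) -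
        typedCount F z (Function.update τ f 0) (fun x y w =>
          iQ ends a₁ a₂ x * (iH ends a₂ b x *
            TypedA3.covKer ends a₁ a₂ (iL ends a₁ o) (sigma ends a₁ a₂ b) y w -
            iL ends a₁ b x *
              TypedA3.covKer ends a₁ a₂ (iH ends a₂ o) (sigma ends a₁ a₂ b) y w)) := by
  have hq := typedCount_pendant_a3_quadratic (R := R) ends o a₁ a₂ a₃ b hf hleaf h3b h3o h31 h32
    h3b F hfF z τ
  have h2 := typedCount_pendant_a3_at_b_two (R := R) ends o a₁ a₂ a₃ b hf hleaf h3b h3o h31 h32 F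
    hfF z τ
  linear_combination h2 - hq

omit [Fintype E] [DecidableEq E] in
/-- The `X`-kernel of the row is a sum of same-side and cross kernels weighted by the spectator's
side of `b`. -/
lemma X_kernel_eq (x y w : Config E) :
    (iQ ends a₁ a₂ x * (iH ends a₂ b x *
        TypedA3.covKer ends a₁ a₂ (iL ends a₁ o) (sigma ends a₁ a₂ b) y w -
        iL ends a₁ b x * TypedA3.covKer ends a₁ a₂ (iH ends a₂ o) (sigma ends a₁ a₂ b) y w) : R) =
      iQ ends a₁ a₂ x * (iH ends a₂ b x *
        (TypedA3.sameKernel ends a₁ a₂ o b y w + crossKernel ends a₁ a₂ o b y w) +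
        iL ends a₁ b x *
          (TypedA3.sameKernel ends a₂ a₁ o b y w + crossKernel ends a₂ a₁ o b y w)) := by
  rw [← covKer_iL_sigma_eq, ← covKer_iH_sigma_mirror_eq]
  have h : TypedA3.covKer (R := R) ends a₁ a₂ (iH ends a₂ o) (sigma ends a₁ a₂ b) y w =
      -TypedA3.covKer (R := R) ends a₁ a₂ (iH ends a₂ o) (sigma ends a₂ a₁ b) y w := by
    unfold TypedA3.covKer sigma iL iH
    ring
  rw [h]
  ring

variable [LinearOrder R] [IsStrictOrderedRing R]

/-- **`X ≥ 0`** under the typed same-side statements for `(o, b)` at both roots and the cross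
statements in both orientations (types in `{1, 2}` off `f`). -/
theorem typedCount_pendant_a3_at_b_X_nonneg {f : E} (F : Finset E) (hfF : f ∈ F)
    (z : Config E) (τ : E → ℕ) (hτ : ∀ e ∈ F, e ≠ f → τ e = 1 ∨ τ e = 2)
    (hs₁ : TypedA3.SameCount (R := R) ends a₁ a₂ o b) (hc₁ : CrossCount R ends a₁ a₂ o b)
    (hs₂ : TypedA3.SameCount (R := R) ends a₂ a₁ o b) (hc₂ : CrossCount R ends a₂ a₁ o b) :
    0 ≤ typedCount F z (Function.update τ f 0) (fun x y w =>
      (iQ ends a₁ a₂ x * (iH ends a₂ b x *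
        TypedA3.covKer ends a₁ a₂ (iL ends a₁ o) (sigma ends a₁ a₂ b) y w -
        iL ends a₁ b x *
          TypedA3.covKer ends a₁ a₂ (iH ends a₂ o) (sigma ends a₁ a₂ b) y w) : R)) := by
  rw [typedCount_type_zero F f hfF _ _ (Function.update_self f 0 τ)]
  have hτ' : ∀ e ∈ F.erase f, Function.update τ f 0 e = 1 ∨ Function.update τ f 0 e = 2 := by
    intro e he
    rw [Function.update_of_ne (Finset.ne_of_mem_erase he)]
    exact hτ e (Finset.mem_of_mem_erase he) (Finset.ne_of_mem_erase he)
  rw [TypedA3.typedCount_eq_sum_spec _ _ _ hτ']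
  refine Finset.sum_nonneg fun x _ => ?_
  split_ifs
  · rw [TypedA3.pinnedCount_congr _ _ _ (fun y w => iQ ends a₁ a₂ x * (iH ends a₂ b x *
        (TypedA3.sameKernel (R := R) ends a₁ a₂ o b y w + crossKernel ends a₁ a₂ o b y w) +
        iL ends a₁ b x *
          (TypedA3.sameKernel (R := R) ends a₂ a₁ o b y w + crossKernel ends a₂ a₁ o b y w)))
        (fun y w => X_kernel_eq ends o a₁ a₂ b x y w),
      TypedA3.pinnedCount_const_mul, TypedA3.pinnedCount_add, TypedA3.pinnedCount_const_mul,
      TypedA3.pinnedCount_const_mul, TypedA3.pinnedCount_add, TypedA3.pinnedCount_add]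
    have hH : (0 : R) ≤ iH ends a₂ b x := by
      unfold iH
      exact Set.indicator_nonneg (fun _ _ => zero_le_one) x
    have hL : (0 : R) ≤ iL ends a₁ b x := by
      unfold iL
      exact Set.indicator_nonneg (fun _ _ => zero_le_one) x
    exact mul_nonneg (TypedA3.iQ_nonneg ends a₁ a₂ x)
      (add_nonneg (mul_nonneg hH (add_nonneg (hs₁ _ _) (hc₁ _ _)))
        (mul_nonneg hL (add_nonneg (hs₂ _ _) (hc₂ _ _))))
  · exact le_rfl

/-- **The row at `b` is bounded above**: `N₁ ≤ 3N₀` and `N₂ ≤ 2N₀ + N₃` under the four two-copy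
statements. -/
theorem typedCount_pendant_a3_at_b_le {f : E} (hf : ends f = s(a₃, b))
    (hleaf : ∀ e, a₃ ∈ ends e → e = f) (h3b : a₃ ≠ b) (h3o : a₃ ≠ o) (h31 : a₃ ≠ a₁)
    (h32 : a₃ ≠ a₂) (F : Finset E) (hfF : f ∈ F) (z : Config E) (τ : E → ℕ)
    (hτ : ∀ e ∈ F, e ≠ f → τ e = 1 ∨ τ e = 2)
    (hs₁ : TypedA3.SameCount (R := R) ends a₁ a₂ o b) (hc₁ : CrossCount R ends a₁ a₂ o b)
    (hs₂ : TypedA3.SameCount (R := R) ends a₂ a₁ o b) (hc₂ : CrossCount R ends a₂ a₁ o b) :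
    typedCount F z (Function.update τ f 1)
        (K3 ends o a₁ a₂ a₃ b : Config E → Config E → Config E → R) ≤
      3 * typedCount F z (Function.update τ f 0) (K3 ends o a₁ a₂ a₃ b) ∧
    typedCount F z (Function.update τ f 2)
        (K3 ends o a₁ a₂ a₃ b : Config E → Config E → Config E → R) ≤
      2 * typedCount F z (Function.update τ f 0) (K3 ends o a₁ a₂ a₃ b) +
        typedCount F z (Function.update τ f 3) (K3 ends o a₁ a₂ a₃ b) := by
  have hX := typedCount_pendant_a3_at_b_X_nonneg ends o a₁ a₂ b (f := f) F hfF z τ hτ hs₁ hc₁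
    hs₂ hc₂
  rw [typedCount_pendant_a3_at_b_one ends o a₁ a₂ a₃ b hf hleaf h3b h3o h31 h32 F hfF z τ,
    typedCount_pendant_a3_at_b_two ends o a₁ a₂ a₃ b hf hleaf h3b h3o h31 h32 F hfF z τ]
  constructor <;> linarith

end Main

end TypedRed

end CovForm

end Summit.Ventures.PercRepro2
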